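import Summits.QuantumFields.BalabanUV.Beta.FP.TorusNestedReadoutRows
import Summits.QuantumFields.BalabanUV.Beta.FP.TowerDoorUniformDataTorus
import Summits.QuantumFields.BalabanUV.Beta.GAN24.PiBmConstants

/-!
# `BalabanUV.Beta.FP.TowerDoorUniformDataNested` — binder row D1, the row's ONE file, LEMMA U ON THE TORUS (J-NOTE-20 §7; K2L-LAM's «Λ_μ constant» as a theorem, the constant being 0):
# **THE NESTED SLICE KILLS THE FACE FIELD, SO THE TREE-GAUGE PARAMETER OF UNIFORM DATA VANISHES ON EVERY BOX** — U2 over road FP g54's (L1) `TorusNestedReadoutRows.nestedRows_apply_ne_zero`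
# (the nested comb rows read only bonds with BOTH unwrapped endpoints inside one big block; a face-crossing bond has its tip in the next block), combined with U1 on the torus (PART 52
# `TowerDoorUniformDataTorus.sum_XN_sources_eq_face`: the one-shot column summed over the torus sources IS the face field) and g53's (D) shape `(N·W₀)·θ = −N·X` with leaf-06 G-2's `det (N·W₀) ≠ 0`
# (β-function cell `pub-balaban`, BINDER-OWNERS row D1 ∕ (C1) OWNER «beta-an2» gen 76, PART 53; imports road g54 (A1) + PART 52)

WHY (located; J-NOTE-19 §4 LEMMA U ∕ J-NOTE-20 §6–§7; by value K2L-LAM Λ constant 4∕4, Engine C, zero weight).  v10's (U) row `hΘ` needs the translation-summed gauge column `Λ_μ = Σ_z λ_(μ,z)` to be door-free; with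
`λ_a = towerEvalC θ_a`, `(N·W₀)·θ_a = −N·XN₁₂(e_a)` ((D) p681260) and linearity, `Σ_{torus sources of direction μ}` gives `(N·W₀)·θ_{uniform} = −N·(face field)` (PART 52), and the right side is ZERO:
(L1) says `N p b ≠ 0` forces `quo L ↑b.1 = quo L (↑b.1 + e_{b.2})` (both the slot's big block), while the face field lives exactly on the bonds where these differ (`int_succ_ediv`).  Hence `θ_{uniform} = 0`
(G-2) and the `hlve`-shaped read-out `Σ_x [x = s]·(E·θ)(towerEquiv x)` vanishes at every finest site — on EVERY box torus, for every comb-root list and every generic step family `Q` under (L1)'s displayed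
two-block letter (TB) (discharged at `QSym Lc` by road g54 (B)).  The LATTICE `hΘ` then needs only (P-c)'s periodisation identity (J-NOTE-20 §8).

WHAT ([folklore] finite `Matrix.mulVec` ∕ floor-division bookkeeping BY NAME; no `def`, no `def … : Prop`, nothing cited, 0 sorry; generic `d`, depth `n+1`, top torus `M` with `Lc ∣ M i`, generic `Q` under (TB)):
§1 `mulVec_eq_zero_of_read_support` (generic); §2 **`nestedRows_mulVec_eq_zero_of_faceSupported`** — `N *ᵥ X = 0` for every `X` vanishing off the big-block face bonds ((L1)); §3 `faceField_faceSupported`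
(`quo L ↑b.1 = quo L (↑b.1 + e_{b.2}) ⟹ [↑b.1_{b.2} % L = L − 1]·c = 0`, gan24 `int_succ_ediv`); §4 **`gaugeParam_eq_zero_of_faceSupported`** (`det (N·W₀) ≠ 0`, `(N·W₀)·θ = −N·X`, `X` face-supported ⟹ `θ = 0`) and
**`treeGauge_readout_eq_zero_of_faceSupported`** (the `hlve` word vanishes); §5 at the wrapper's leg letters with PART 52: `toBlocks₁₂_mulVec_uniform` (`XN.toBlocks₁₂ *ᵥ Sum.elim 𝟙_μ 0` at row `b` IS the source sum
of PART 52), **`gaugeParam_uniform_eq_zero`** and **`treeGauge_readout_uniform_eq_zero`**: for the record's chart `scaleK σ σ (AN R j)` on `T = Lc^(j+1)•M′`, under `hLN hEAN hfN`, (TB), `det ≠ 0` and the (D)-shaped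
equation for the uniform indicator `v = 𝟙_{(·).2 = μ}`: `θ = 0` and `Σ_x [x = s]·(E·θ)(towerEquiv x) = 0` — LEMMA U ON THE TORUS.
WHAT THIS IS NOT: not the lattice `hΘ` (needs (P-c)); not (TB)'s discharge (road (B)); not (D)'s instantiation (its 40 binders are fed by the consumer with one `exact`); the door NOT defined; every wrapper letter a DISPLAYED
hypothesis; nothing of Bałaban's asserted, valued or discharged; 0 estimates; 0∕4 row-D1 binders (hW, hR, D1Tel, D1Rep); v10 NOT filed; v9 p617999 stands; NOT (C1), NOT (T-ID), NOT D1, NEVER «G-an2-4 closed», NOT BetaPertH,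
NOT continuum, NOT Clay.

HONEST DEPENDENCY (page 1, mandatory): continuum YM on T⁴ ⇐ BetaPertH ∧ nine spine estimates (0/9 proved); BetaPertH ⇐ (D1) ∧ (D4) ∧ CAP+tail;
G-an2-4 gates asym, D1 and NE2/3/4.  HONEST FRAMING (cell contract, verbatim): «discharging `BetaPertH` makes Bałaban's UV stability UNCONDITIONAL —
a real constructive-QFT result; it is NOT the continuum limit and NOT the Clay problem.»  ABSOLUTE RULE (cell charter, verbatim): «No internally-minted
statement may enter as a cited fact. Every hypothesis is either kernel-proved in this package or a verbatim quotation of a PUBLISHED theorem with page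
reference. The manuscript(s) under audit are NOT citable for their own disputed steps — they are the thing under adjudication; programme-internal
(2001/route/tribunal) claims are never citable.»  Row D1 ∕ (C1) OWNER «beta-an2» gen 76, 2026-08-29.  No existing file touched.
-/

noncomputable section

open Finset Matrix
open scoped BigOperators
open Literature.MathematicalPhysics.QuantumFieldTheory
open Literature.MathematicalPhysics.QuantumFieldTheory.Balaban1983to89
open Literature.MathematicalPhysics.QuantumFieldTheory.Balaban1983to89.Beta
open B5Prop11Plancherel (fine)
open B6Lemma24Torus (pbox)
open AffineAveraging (Site toSite unitVec unitVec_apply)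
open OneStepResolventKernel (Fib)
open ExpKernelCalculus (MKer)
open HessKerRate (scaleK)
open Literature.MathematicalPhysics.QuantumFieldTheory.LatticeForm (quo)
open Summit.QuantumFields.BalabanUV.Beta.AxialDressingRooted (axEc)
open Summit.QuantumFields.BalabanUV.Beta.CompositeOneShotJetData (Roots AN)
open Summit.QuantumFields.BalabanUV.Beta.FP.KernelPeriodisationFib (Idx perF)
open Summit.QuantumFields.BalabanUV.Beta.FP.TorusGaugeCovariancePairing (wrapPt)
open Summit.QuantumFields.BalabanUV.Beta.FP.TorusCombRows (Res)
open Summit.QuantumFields.BalabanUV.Beta.FP.TorusCompositeObjects (towerTorus NParam combF bigP towerGen bigRoot bigRatio towerEquiv)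
open Summit.QuantumFields.BalabanUV.Beta.FP.TorusCompositeObjectsG (StepRows compRowsG)
open Summit.QuantumFields.BalabanUV.Beta.FP.TorusCompositeUnimodular (towerEvalC)
open Summit.QuantumFields.BalabanUV.Beta.FP.TorusNestedReadoutRows (nestedRows_apply_ne_zero)
open Summit.QuantumFields.BalabanUV.Beta.FP.TowerDoorUniformDataTorus (sum_XN_sources_eq_face)
open Summit.QuantumFields.BalabanUV.Beta.GAN24.PiBmConstants (int_succ_ediv)

namespace Summit.QuantumFields.BalabanUV.Beta.FP.TowerDoorUniformDataNested

variable {d : ℕ}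

/-! ## §1 Generic: a matrix whose rows read only a support kills every vector vanishing there -/

/-- [folklore] if every non-zero entry `N p b` has `P b`, and `X` vanishes on `P`, then `N *ᵥ X = 0`. -/
theorem mulVec_eq_zero_of_read_support {ι κ : Type*} [Fintype κ] {N : Matrix ι κ ℝ} {P : κ → Prop} (hN : ∀ p b, N p b ≠ 0 → P b)
    {X : κ → ℝ} (hX : ∀ b, P b → X b = 0) : N *ᵥ X = 0 := by
  funext p
  rw [Pi.zero_apply, Matrix.mulVec, dotProduct]
  refine Finset.sum_eq_zero fun b _ => ?_
  by_cases h : N p b = 0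
  · rw [h, zero_mul]
  · rw [hX b (hN p b h), mul_zero]

/-! ## §2 U2: the nested slice kills every face-supported column -/

section Slice

variable (Lc : ℕ) [NeZero Lc] (Q : StepRows d Lc)
  (hQ : ∀ (M : Fin (d + 1) → ℕ) [∀ μ, NeZero (M μ)] (ℓ : ℕ) (r : Fin (d + 1) → ℕ) (a : ↥(pbox M)) (ν : Fin (d + 1))
      (b : ↥(pbox (fine Lc M))) (κ : Fin (d + 1)),
      (a : Site (d + 1)) + unitVec ν ∈ pbox M → Q M ℓ r (a, ν) (b, κ) ≠ 0 →
        (quo Lc (b : Site (d + 1)) = a ∨ quo Lc (b : Site (d + 1)) = (a : Site (d + 1)) + unitVec ν) ∧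
        (quo Lc ((b : Site (d + 1)) + unitVec κ) = a ∨ quo Lc ((b : Site (d + 1)) + unitVec κ) = (a : Site (d + 1)) + unitVec ν))
  (M : Fin (d + 1) → ℕ) [∀ μ, NeZero (M μ)] (lev : ℕ → ℕ) (rs : ℕ → (Fin (d + 1) → ℕ))
  (hrs : ∀ k i, 0 ≤ toSite (rs k) i ∧ toSite (rs k) i < (Lc : ℤ)) (hM : ∀ i, Lc ∣ M i) (n : ℕ)
include hQ hM

/-- [folklore] **`nestedRows_mulVec_eq_zero_of_faceSupported` — U2**: under (L1)'s letters, the nested slice `N = fromRows (τ₂·Q₁₀) τ₁` kills every column `X` that vanishes on the bonds whose two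
(unwrapped) endpoints share their big block: `(∀ b, quo L ↑b.1 = quo L (↑b.1 + e_{b.2}) → X b = 0) → N *ᵥ X = 0` (road g54 `nestedRows_apply_ne_zero` + §1). -/
theorem nestedRows_mulVec_eq_zero_of_faceSupported
    {Q₁₀ : Matrix (↥(pbox M) × Fin (d + 1)) (↥(pbox (towerTorus Lc M (n + 1))) × Fin (d + 1)) ℝ} (hQ₁₀ : Q₁₀ = compRowsG Lc Q M lev rs (n + 1))
    {τ₁ : Matrix (NParam Lc (fine Lc M) (fun k => rs (k + 1)) n) (↥(pbox (towerTorus Lc M (n + 1))) × Fin (d + 1)) ℝ}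
    (hτ₁ : τ₁ = bigP Lc (fine Lc M) (fun k => rs (k + 1)) (fun k => hrs (k + 1)) n)
    {τ₂ : Matrix (Res (toSite (rs 0)) Lc M) (↥(pbox M) × Fin (d + 1)) ℝ} (hτ₂ : τ₂ = combF Lc M (rs 0))
    {N : Matrix (NParam Lc M rs (n + 1)) (↥(pbox (towerTorus Lc M (n + 1))) × Fin (d + 1)) ℝ} (hN : N = Matrix.fromRows (τ₂ * Q₁₀) τ₁)
    {X : ↥(pbox (towerTorus Lc M (n + 1))) × Fin (d + 1) → ℝ}
    (hX : ∀ b : ↥(pbox (towerTorus Lc M (n + 1))) × Fin (d + 1),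
      quo (bigRatio Lc (n + 1)) (b.1 : Site (d + 1)) = quo (bigRatio Lc (n + 1)) ((b.1 : Site (d + 1)) + unitVec b.2) → X b = 0) :
    N *ᵥ X = 0 := by
  subst hQ₁₀ hτ₁ hτ₂ hN
  refine mulVec_eq_zero_of_read_support
    (P := fun b : ↥(pbox (towerTorus Lc M (n + 1))) × Fin (d + 1) =>
      quo (bigRatio Lc (n + 1)) (b.1 : Site (d + 1)) = quo (bigRatio Lc (n + 1)) ((b.1 : Site (d + 1)) + unitVec b.2)) (fun p b h => ?_) hX
  obtain ⟨h1, h2⟩ := nestedRows_apply_ne_zero Lc Q hQ M lev rs hrs hM n p b h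
  rw [h1, h2]

end Slice

/-! ## §3 The face field is face-supported -/

/-- [folklore] **a bond whose endpoints share their `L`-block is not a face bond**: `quo L x = quo L (x + e_κ) ⟹ x_κ % L ≠ L − 1` (gan24 `int_succ_ediv`), so the face field's value there is `0`. -/
theorem faceField_faceSupported {L : ℕ} (hL : 1 ≤ L) (c : Fin (d + 1) → Site (d + 1) → ℝ) (κ : Fin (d + 1)) (x : Site (d + 1))
    (h : quo L x = quo L (x + unitVec κ)) :
    (if x κ % ((L : ℕ) : ℤ) = ((L : ℕ) : ℤ) - 1 then c κ x else 0) = 0 := by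
  rw [if_neg]
  intro hf
  have e := congrFun h κ
  simp only [quo, Pi.add_apply, unitVec_apply, if_true] at e
  rw [int_succ_ediv (by exact_mod_cast hL) (x κ), if_pos hf] at e
  omega

/-! ## §4 The gauge parameter of a face-supported column vanishes -/

section Gauge

variable {ι κ : Type*} [Fintype ι] [DecidableEq ι] [Fintype κ]

/-- [folklore] **`gaugeParam_eq_zero_of_mulVec_eq_zero`**: `det (N·W₀) ≠ 0`, `(N·W₀)·θ = −N·X` and `N·X = 0` give `θ = 0`. -/
theorem gaugeParam_eq_zero_of_mulVec_eq_zero {N : Matrix ι κ ℝ} {W₀ : Matrix κ ι ℝ} (hTW : (N * W₀).det ≠ 0)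
    {θ : ι → ℝ} {X : κ → ℝ} (hθ : (N * W₀) *ᵥ θ = -(N *ᵥ X)) (hNX : N *ᵥ X = 0) : θ = 0 := by
  have hu : IsUnit (N * W₀).det := isUnit_iff_ne_zero.mpr hTW
  rw [hNX, neg_zero] at hθ
  have e : (N * W₀)⁻¹ *ᵥ ((N * W₀) *ᵥ θ) = 0 := by rw [hθ, Matrix.mulVec_zero]
  rwa [Matrix.mulVec_mulVec, Matrix.nonsing_inv_mul _ hu, Matrix.one_mulVec] at e

/-- [folklore] … hence every read-out of `θ` vanishes, in particular the `hlve`-shaped tree-gauge word `Σ_x [x = s]·(E·θ)(eqv x) = 0`. -/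
theorem treeGauge_readout_eq_zero_of_mulVec_eq_zero {ρ σ : Type*} [Fintype ρ] [DecidableEq σ] {N : Matrix ι κ ℝ} {W₀ : Matrix κ ι ℝ}
    (hTW : (N * W₀).det ≠ 0) {θ : ι → ℝ} {X : κ → ℝ} (hθ : (N * W₀) *ᵥ θ = -(N *ᵥ X)) (hNX : N *ᵥ X = 0)
    (E : Matrix ι ι ℝ) (pt : ρ → σ) (eqv : ρ → ι) (s : σ) :
    (∑ x : ρ, (if pt x = s then (E *ᵥ θ) (eqv x) else 0)) = 0 := by
  rw [gaugeParam_eq_zero_of_mulVec_eq_zero hTW hθ hNX, Matrix.mulVec_zero]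
  simp

end Gauge

/-! ## §5 At the wrapper's leg letters: the uniform indicator's gauge parameter vanishes — LEMMA U on the torus -/

section Wrapper

variable {Lc : ℕ} [NeZero Lc] (R : Roots Lc) (j : ℕ)

/-- [folklore] **the one-shot right inverse applied to the uniform indicator of direction `μ`, at a field row, IS PART 52's source sum**:
`(XN.toBlocks₁₂ *ᵥ Sum.elim 𝟙_μ 0) b = Σ_{r : pbox M′} XN (inl b) (inr (inl (slot⁻¹ (r, μ))))`. -/
theorem toBlocks₁₂_mulVec_uniform (T M' : Fin (3 + 1) → ℕ) {κs ρs : Type*} [Fintype κs] [Fintype ρs]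
    (slot : κs ≃ ↥(pbox M') × Fin (3 + 1))
    (XN : Matrix ((↥(pbox T) × Fin (3 + 1)) ⊕ (κs ⊕ ρs)) ((↥(pbox T) × Fin (3 + 1)) ⊕ (κs ⊕ ρs)) ℝ)
    (μ : Fin (3 + 1)) (b : ↥(pbox T) × Fin (3 + 1)) :
    (XN.toBlocks₁₂ *ᵥ Sum.elim (fun a : κs => if (slot a).2 = μ then (1 : ℝ) else 0) (fun _ : ρs => 0)) b
      = ∑ r : ↥(pbox M'), XN (Sum.inl b) (Sum.inr (Sum.inl (slot.symm (r, μ)))) := by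
  rw [Matrix.mulVec, dotProduct, Fintype.sum_sum_type]
  simp only [Matrix.toBlocks₁₂, Matrix.of_apply, Sum.elim_inl, Sum.elim_inr, mul_zero, Finset.sum_const_zero, add_zero,
    mul_ite, mul_one]
  rw [← slot.symm.sum_comp, Fintype.sum_prod_type]
  refine Finset.sum_congr rfl fun r _ => ?_
  simp only [Equiv.apply_symm_apply]
  rw [Finset.sum_ite_eq' Finset.univ μ, if_pos (Finset.mem_univ μ)]

/-- [folklore] **`gaugeParam_uniform_eq_zero` — LEMMA U ON THE TORUS**: on the torus `T = Lc^(j+1)•M′` with the record's chart `scaleK σ σ (AN R j)`, under the wrapper's leg letters `hLN hEAN hfN`, road g54's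
letters for the nested slice `N` (generic `Q` under (TB), `Lc ∣ M′ i`, `Lc^(j+1) = bigRatio`-compatibility `hLb`), leaf-06 G-2's `det (N·W₀) ≠ 0`, and the (D)-shaped equation for the uniform indicator
`(N·W₀)·θ = −N·(XN₁₂·Sum.elim 𝟙_μ 0)`: **`θ = 0`** — the tree-gauge parameter of uniform data vanishes (PART 52: the column is the face field; §2∕§3: the nested slice kills it). -/
theorem gaugeParam_uniform_eq_zero (Q : StepRows 3 Lc)
    (hQ : ∀ (M : Fin (3 + 1) → ℕ) [∀ μ, NeZero (M μ)] (ℓ : ℕ) (r : Fin (3 + 1) → ℕ) (a : ↥(pbox M)) (ν : Fin (3 + 1))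
      (b : ↥(pbox (fine Lc M))) (κ : Fin (3 + 1)),
      (a : Site (3 + 1)) + unitVec ν ∈ pbox M → Q M ℓ r (a, ν) (b, κ) ≠ 0 →
        (quo Lc (b : Site (3 + 1)) = a ∨ quo Lc (b : Site (3 + 1)) = (a : Site (3 + 1)) + unitVec ν) ∧
        (quo Lc ((b : Site (3 + 1)) + unitVec κ) = a ∨ quo Lc ((b : Site (3 + 1)) + unitVec κ) = (a : Site (3 + 1)) + unitVec ν))
    (M : Fin (3 + 1) → ℕ) [∀ μ, NeZero (M μ)] (lev : ℕ → ℕ) (rs : ℕ → (Fin (3 + 1) → ℕ))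
    (hrs : ∀ k i, 0 ≤ toSite (rs k) i ∧ toSite (rs k) i < (Lc : ℤ)) (hM : ∀ i, Lc ∣ M i) (n : ℕ)
    (hLb : bigRatio Lc (n + 1) = Lc ^ (j + 1))
    (M' : Fin (3 + 1) → ℕ) [∀ i, NeZero (M' i)] (hT : ∀ i, towerTorus Lc M (n + 1) i = Lc ^ (j + 1) * M' i)
    {Q₁₀ : Matrix (↥(pbox M) × Fin (3 + 1)) (↥(pbox (towerTorus Lc M (n + 1))) × Fin (3 + 1)) ℝ} (hQ₁₀ : Q₁₀ = compRowsG Lc Q M lev rs (n + 1))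
    {τ₁ : Matrix (NParam Lc (fine Lc M) (fun k => rs (k + 1)) n) (↥(pbox (towerTorus Lc M (n + 1))) × Fin (3 + 1)) ℝ}
    (hτ₁ : τ₁ = bigP Lc (fine Lc M) (fun k => rs (k + 1)) (fun k => hrs (k + 1)) n)
    {τ₂ : Matrix (Res (toSite (rs 0)) Lc M) (↥(pbox M) × Fin (3 + 1)) ℝ} (hτ₂ : τ₂ = combF Lc M (rs 0))
    {N : Matrix (NParam Lc M rs (n + 1)) (↥(pbox (towerTorus Lc M (n + 1))) × Fin (3 + 1)) ℝ} (hN : N = Matrix.fromRows (τ₂ * Q₁₀) τ₁)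
    {W₀ : Matrix (↥(pbox (towerTorus Lc M (n + 1))) × Fin (3 + 1)) (NParam Lc M rs (n + 1)) ℝ} (hTW : (N * W₀).det ≠ 0)
    {κs ρs : Type*} [Fintype κs] [Fintype ρs] (σ : Fib 3 → ℝ) (ρN : Site (3 + 1)) (LNc : ℕ) (fN : κs → Idx (towerTorus Lc M (n + 1)) (Fib 3))
    (slot : κs ≃ ↥(pbox M') × Fin (3 + 1))
    (hfN : ∀ a : κs, fN a = (wrapPt (towerTorus Lc M (n + 1)) (((Lc ^ (j + 1) : ℕ) : ℤ) • ((slot a).1 : Site (3 + 1))), Sum.inr (slot a).2))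
    {XN : Matrix ((↥(pbox (towerTorus Lc M (n + 1))) × Fin (3 + 1)) ⊕ (κs ⊕ ρs)) ((↥(pbox (towerTorus Lc M (n + 1))) × Fin (3 + 1)) ⊕ (κs ⊕ ρs)) ℝ}
    (hEAN : perF (towerTorus Lc M (n + 1)) (axEc ρN LNc) * perF (towerTorus Lc M (n + 1)) (scaleK σ σ (AN R j)) = perF (towerTorus Lc M (n + 1)) (scaleK σ σ (AN R j)))
    (hLN : XN.submatrix (Sum.map id Sum.inl) (Sum.map id Sum.inl) = fromBlocks
      (Matrix.of fun (b b' : (↥(pbox (towerTorus Lc M (n + 1))) × Fin (3 + 1))) =>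
        axEc ρN LNc (b.1 : Site (3 + 1)) (b.1 : Site (3 + 1)) (Sum.inl b.2) (Sum.inl b.2)
          * (axEc ρN LNc (b'.1 : Site (3 + 1)) (b'.1 : Site (3 + 1)) (Sum.inl b'.2) (Sum.inl b'.2)
            * perF (towerTorus Lc M (n + 1)) (scaleK σ σ (AN R j)) (b.1, Sum.inl b.2) (b'.1, Sum.inl b'.2)))
      (Matrix.of fun (b : (↥(pbox (towerTorus Lc M (n + 1))) × Fin (3 + 1))) (a : κs) =>
        axEc ρN LNc (b.1 : Site (3 + 1)) (b.1 : Site (3 + 1)) (Sum.inl b.2) (Sum.inl b.2) * perF (towerTorus Lc M (n + 1)) (scaleK σ σ (AN R j)) (b.1, Sum.inl b.2) (fN a))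
      (-Matrix.of fun (a : κs) (b : (↥(pbox (towerTorus Lc M (n + 1))) × Fin (3 + 1))) =>
        axEc ρN LNc (b.1 : Site (3 + 1)) (b.1 : Site (3 + 1)) (Sum.inl b.2) (Sum.inl b.2) * perF (towerTorus Lc M (n + 1)) (scaleK σ σ (AN R j)) (fN a) (b.1, Sum.inl b.2))
      (-((perF (towerTorus Lc M (n + 1)) (scaleK σ σ (AN R j))).submatrix fN fN)))
    (μ : Fin (3 + 1)) {θ : NParam Lc M rs (n + 1) → ℝ}
    (hθ : (N * W₀) *ᵥ θ = -(N *ᵥ (XN.toBlocks₁₂ *ᵥ Sum.elim (fun a : κs => if (slot a).2 = μ then (1 : ℝ) else 0) (fun _ : ρs => 0)))) :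
    θ = 0 := by
  have hL1 : 1 ≤ Lc ^ (j + 1) := Nat.one_le_iff_ne_zero.mpr (NeZero.ne (Lc ^ (j + 1)))
  refine gaugeParam_eq_zero_of_mulVec_eq_zero hTW hθ ?_
  refine nestedRows_mulVec_eq_zero_of_faceSupported Lc Q hQ M lev rs hrs hM n hQ₁₀ hτ₁ hτ₂ hN (fun b hb => ?_)
  rw [toBlocks₁₂_mulVec_uniform, sum_XN_sources_eq_face R j (towerTorus Lc M (n + 1)) M' hT σ ρN LNc fN slot hfN hEAN hLN b μ]
  rw [hLb] at hb
  have h0 := faceField_faceSupported (d := 3) hL1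
    (fun κ x => σ (Sum.inl κ) * σ (Sum.inr μ) * (((Lc ^ (j + 1) : ℕ) : ℝ) * (if κ = μ then ((((Lc ^ (j + 1) : ℕ) : ℝ) ^ (3 + 1 + 1))⁻¹) else 0)))
    b.2 (b.1 : Site (3 + 1)) hb
  rw [← h0]
  split_ifs <;> ring

/-- [folklore] **`treeGauge_readout_uniform_eq_zero` — … AND THE `hlve`-SHAPED TREE-GAUGE READ-OUT OF UNIFORM DATA VANISHES AT EVERY FINEST SITE** (`Λ_μ = 0` on the torus): same letters,
`Σ_{x : Res} [x.1 = s]·(E *ᵥ θ)(towerEquiv x) = 0` for every `E` (at the wrapper `E = towerEvalC …`). -/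
theorem treeGauge_readout_uniform_eq_zero (Q : StepRows 3 Lc)
    (hQ : ∀ (M : Fin (3 + 1) → ℕ) [∀ μ, NeZero (M μ)] (ℓ : ℕ) (r : Fin (3 + 1) → ℕ) (a : ↥(pbox M)) (ν : Fin (3 + 1))
      (b : ↥(pbox (fine Lc M))) (κ : Fin (3 + 1)),
      (a : Site (3 + 1)) + unitVec ν ∈ pbox M → Q M ℓ r (a, ν) (b, κ) ≠ 0 →
        (quo Lc (b : Site (3 + 1)) = a ∨ quo Lc (b : Site (3 + 1)) = (a : Site (3 + 1)) + unitVec ν) ∧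
        (quo Lc ((b : Site (3 + 1)) + unitVec κ) = a ∨ quo Lc ((b : Site (3 + 1)) + unitVec κ) = (a : Site (3 + 1)) + unitVec ν))
    (M : Fin (3 + 1) → ℕ) [∀ μ, NeZero (M μ)] (lev : ℕ → ℕ) (rs : ℕ → (Fin (3 + 1) → ℕ))
    (hrs : ∀ k i, 0 ≤ toSite (rs k) i ∧ toSite (rs k) i < (Lc : ℤ)) (hM : ∀ i, Lc ∣ M i) (n : ℕ)
    (hLb : bigRatio Lc (n + 1) = Lc ^ (j + 1))
    (M' : Fin (3 + 1) → ℕ) [∀ i, NeZero (M' i)] (hT : ∀ i, towerTorus Lc M (n + 1) i = Lc ^ (j + 1) * M' i)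
    {Q₁₀ : Matrix (↥(pbox M) × Fin (3 + 1)) (↥(pbox (towerTorus Lc M (n + 1))) × Fin (3 + 1)) ℝ} (hQ₁₀ : Q₁₀ = compRowsG Lc Q M lev rs (n + 1))
    {τ₁ : Matrix (NParam Lc (fine Lc M) (fun k => rs (k + 1)) n) (↥(pbox (towerTorus Lc M (n + 1))) × Fin (3 + 1)) ℝ}
    (hτ₁ : τ₁ = bigP Lc (fine Lc M) (fun k => rs (k + 1)) (fun k => hrs (k + 1)) n)
    {τ₂ : Matrix (Res (toSite (rs 0)) Lc M) (↥(pbox M) × Fin (3 + 1)) ℝ} (hτ₂ : τ₂ = combF Lc M (rs 0))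
    {N : Matrix (NParam Lc M rs (n + 1)) (↥(pbox (towerTorus Lc M (n + 1))) × Fin (3 + 1)) ℝ} (hN : N = Matrix.fromRows (τ₂ * Q₁₀) τ₁)
    {W₀ : Matrix (↥(pbox (towerTorus Lc M (n + 1))) × Fin (3 + 1)) (NParam Lc M rs (n + 1)) ℝ} (hTW : (N * W₀).det ≠ 0)
    (E : Matrix (NParam Lc M rs (n + 1)) (NParam Lc M rs (n + 1)) ℝ)
    {κs ρs : Type*} [Fintype κs] [Fintype ρs] (σ : Fib 3 → ℝ) (ρN : Site (3 + 1)) (LNc : ℕ) (fN : κs → Idx (towerTorus Lc M (n + 1)) (Fib 3))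
    (slot : κs ≃ ↥(pbox M') × Fin (3 + 1))
    (hfN : ∀ a : κs, fN a = (wrapPt (towerTorus Lc M (n + 1)) (((Lc ^ (j + 1) : ℕ) : ℤ) • ((slot a).1 : Site (3 + 1))), Sum.inr (slot a).2))
    {XN : Matrix ((↥(pbox (towerTorus Lc M (n + 1))) × Fin (3 + 1)) ⊕ (κs ⊕ ρs)) ((↥(pbox (towerTorus Lc M (n + 1))) × Fin (3 + 1)) ⊕ (κs ⊕ ρs)) ℝ}
    (hEAN : perF (towerTorus Lc M (n + 1)) (axEc ρN LNc) * perF (towerTorus Lc M (n + 1)) (scaleK σ σ (AN R j)) = perF (towerTorus Lc M (n + 1)) (scaleK σ σ (AN R j)))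
    (hLN : XN.submatrix (Sum.map id Sum.inl) (Sum.map id Sum.inl) = fromBlocks
      (Matrix.of fun (b b' : (↥(pbox (towerTorus Lc M (n + 1))) × Fin (3 + 1))) =>
        axEc ρN LNc (b.1 : Site (3 + 1)) (b.1 : Site (3 + 1)) (Sum.inl b.2) (Sum.inl b.2)
          * (axEc ρN LNc (b'.1 : Site (3 + 1)) (b'.1 : Site (3 + 1)) (Sum.inl b'.2) (Sum.inl b'.2)
            * perF (towerTorus Lc M (n + 1)) (scaleK σ σ (AN R j)) (b.1, Sum.inl b.2) (b'.1, Sum.inl b'.2)))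
      (Matrix.of fun (b : (↥(pbox (towerTorus Lc M (n + 1))) × Fin (3 + 1))) (a : κs) =>
        axEc ρN LNc (b.1 : Site (3 + 1)) (b.1 : Site (3 + 1)) (Sum.inl b.2) (Sum.inl b.2) * perF (towerTorus Lc M (n + 1)) (scaleK σ σ (AN R j)) (b.1, Sum.inl b.2) (fN a))
      (-Matrix.of fun (a : κs) (b : (↥(pbox (towerTorus Lc M (n + 1))) × Fin (3 + 1))) =>
        axEc ρN LNc (b.1 : Site (3 + 1)) (b.1 : Site (3 + 1)) (Sum.inl b.2) (Sum.inl b.2) * perF (towerTorus Lc M (n + 1)) (scaleK σ σ (AN R j)) (fN a) (b.1, Sum.inl b.2))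
      (-((perF (towerTorus Lc M (n + 1)) (scaleK σ σ (AN R j))).submatrix fN fN)))
    (μ : Fin (3 + 1)) {θ : NParam Lc M rs (n + 1) → ℝ}
    (hθ : (N * W₀) *ᵥ θ = -(N *ᵥ (XN.toBlocks₁₂ *ᵥ Sum.elim (fun a : κs => if (slot a).2 = μ then (1 : ℝ) else 0) (fun _ : ρs => 0))))
    (s : ↥(pbox (towerTorus Lc M (n + 1)))) :
    (∑ x : Res (bigRoot Lc rs (n + 1)) (bigRatio Lc (n + 1)) (towerTorus Lc M (n + 1)),
        (if (x.1 : ↥(pbox (towerTorus Lc M (n + 1)))) = s then (E *ᵥ θ) (towerEquiv Lc M rs hrs (n + 1) x) else 0)) = 0 := by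
  rw [gaugeParam_uniform_eq_zero R j Q hQ M lev rs hrs hM n hLb M' hT hQ₁₀ hτ₁ hτ₂ hN hTW σ ρN LNc fN slot hfN hEAN hLN μ hθ, Matrix.mulVec_zero]
  simp

end Wrapper

end Summit.QuantumFields.BalabanUV.Beta.FP.TowerDoorUniformDataNested

end
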